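import Mathlib
import Summits.ValiantsHypothesis.ValiantsHypothesis.Theses.FifoMatching
import Summits.ValiantsHypothesis.ValiantsHypothesis.Theorems.FifoMatchingNNNotVPSpreadCofactorIffExpHard
import HarnessLib

/-!
# Route FifoMatching — crux `NNNotVP` (stmt-ValiantsHypothesis-11615), line `division_split`:
# with B2 in hand, the transfer stub Z may be weakened to SUB-EXPONENTIAL rate

Registered line `Cruxes/NNNotVP/Lines/division_split.lean`; objects `σ` / `NN` = the line's
vocabulary (`Theorems/FifoMatchingNNNotVPDivisionSplitDefs.lean`).

The line composes `NNNotVP ⟸ Z ∧ A ∧ B1 ∧ B2` with Z = `ZeroOneTransfer` (stmt-5066, transfer at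
QUASI-POLYNOMIAL rate: a 0/1 `VP_ℂ` family has `min_h L₊(f_n h) + L₊(h) ≤ 2^((log₂ n + c)^c)`) and
A, B1 landed.  By `spreadCofactorReduction_iff_expDivisionHard` (companion file) the remaining stub B2
IS exponential division hardness of `NN` (`cost ≥ 2^{n^{1/r}}`), which beats not only every
quasi-polynomial but every SUB-EXPONENTIAL bound.  Hence the line's transfer stub is OVER-PRICED:
next to B2 it suffices to ask the transfer at sub-exponential rate,

  `Z_se`: every 0/1-coefficient `VP_ℂ` family has, for every `r`, eventually in `n`, a nonzero
  `h ∈ ℝ≥0[x]` with `(log₂ (L₊(f_n · h) + L₊(h)))^r < n` (i.e. cost `< 2^{n^{1/r}}`),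

a consequence of Z (`subexpTransfer_of_zeroOneTransfer`) and a strictly more plausible transfer
(monotone computation with one division at cost `2^{n^{o(1)}}` instead of `2^{polylog n}`):

* `subexpTransfer_of_zeroOneTransfer` — Z ⟹ Z_se;
* ★ `nnNotVP_of_subexpTransfer_of_expDivisionHard` — Z_se ∧ ExpDivisionHard(NN) ⟹ `NNNotVP` BY NAME;
* ★ `nnNotVP_of_subexpTransfer_of_spreadCofactorReduction` — Z_se ∧ B2 ⟹ `NNNotVP` BY NAME (the
  line's composition with its Z stub weakened; B2 verbatim).

So the crux has two incomparable two-piece covers by name: `Z ∧ NNDivisionHard` (✓ `nnNotVP_of_subs`)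
and `Z_se ∧ ExpDivisionHard(NN)` (this file).  Honest framing: glue between OPEN statements (a
planning fact for the line, whose registered skeleton this LAND-ONLY file does not touch); Z, Z_se,
B2, both division-hardness statements, the crux `NNNotVP` and `VP ≠ VNP` stay OPEN (NOT proved).
No definitions, no named facts.
-/

noncomputable section

-- Sub = Summit single-conjunct layout: the duplicated namespace component is mandated by the tree.
set_option linter.dupNamespace false

namespace Summit.ValiantsHypothesis.ValiantsHypothesis.Theorems.FifoMatching.NNNotVP.DivisionSplit

open MvPolynomial Literature.Computability.AlgebraicComplexity
open scoped NNReal BigOperators Classical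

/-- **Z ⟹ Z_se**: the quasi-polynomial transfer (`ZeroOneTransfer`, stmt-ValiantsHypothesis-5066,
verbatim) implies the sub-exponential transfer (`(log₂ cost)^r < n` eventually, for every `r`),
since `((log₂ n + c)^c)^r` is eventually below `n`. [folklore] -/
theorem subexpTransfer_of_zeroOneTransfer
    (hZ : ∀ (σ : ℕ → Type) [∀ n, Fintype (σ n)] (f : ∀ n, MvPolynomial (σ n) NNReal), (∀ n m, MvPolynomial.coeff m (f n) = 0 ∨ MvPolynomial.coeff m (f n) = 1) → Literature.Computability.AlgebraicComplexity.IsVPFamily (k := ℂ) (fun n => MvPolynomial.map (Complex.ofRealHom.comp NNReal.toRealHom) (f n)) → ∃ c : ℕ, ∀ n, ∃ h : MvPolynomial (σ n) NNReal, h ≠ 0 ∧ Literature.Computability.AlgebraicComplexity.complexity (f n * h) + Literature.Computability.AlgebraicComplexity.complexity h ≤ 2 ^ ((Nat.log 2 n + c) ^ c)) :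
    ∀ (σ : ℕ → Type) [∀ n, Fintype (σ n)] (f : ∀ n, MvPolynomial (σ n) NNReal),
      (∀ n m, MvPolynomial.coeff m (f n) = 0 ∨ MvPolynomial.coeff m (f n) = 1) →
      Literature.Computability.AlgebraicComplexity.IsVPFamily (k := ℂ)
        (fun n => MvPolynomial.map (Complex.ofRealHom.comp NNReal.toRealHom) (f n)) →
      ∀ r : ℕ, ∃ n₀ : ℕ, ∀ n ≥ n₀, ∃ h : MvPolynomial (σ n) NNReal, h ≠ 0 ∧
        (Nat.log 2 (complexity (f n * h) + complexity h)) ^ r < n := by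
  intro τ _ f hf hVP r
  obtain ⟨c, hc⟩ := hZ τ f hf hVP
  obtain ⟨n₀, hn₀⟩ := eventually_polylog_lt c (c * r)
  refine ⟨n₀, fun n hn => ?_⟩
  obtain ⟨h, hh, hle⟩ := hc n
  refine ⟨h, hh, ?_⟩
  have hlog : Nat.log 2 (complexity (f n * h) + complexity h) ≤ (Nat.log 2 n + c) ^ c :=
    calc Nat.log 2 (complexity (f n * h) + complexity h)
        ≤ Nat.log 2 (2 ^ ((Nat.log 2 n + c) ^ c)) := Nat.log_mono_right hle
      _ = (Nat.log 2 n + c) ^ c := Nat.log_pow (by norm_num) _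
  calc (Nat.log 2 (complexity (f n * h) + complexity h)) ^ r
      ≤ ((Nat.log 2 n + c) ^ c) ^ r := Nat.pow_le_pow_left hlog r
    _ = (Nat.log 2 n + c) ^ (c * r) := by rw [← pow_mul]
    _ ≤ (2 * Nat.log 2 n + c) ^ (c * r) := Nat.pow_le_pow_left (by omega) _
    _ < n := hn₀ n hn

/-- ★ **Z_se ∧ ExpDivisionHard(NN) ⟹ `NNNotVP` BY NAME.**  If every 0/1-coefficient `VP_ℂ` family
admits, for every `r`, eventually a nonzero cofactor of cost `(log₂ (L₊(f_n h) + L₊(h)))^r < n`, and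
`NN` has exponential division hardness (`n ≤ (log₂ cost)^r` eventually for ALL nonzero `h`), then the
nest-free matching family is not in `VP_ℂ`: applied to `f = NN` over `ℝ≥0` (0/1 coefficients, its
complexification is the route's `NN` over `ℂ`) the two bounds collide at a common large level.
[folklore] -/
theorem nnNotVP_of_subexpTransfer_of_expDivisionHard
    (hZse : ∀ (σ : ℕ → Type) [∀ n, Fintype (σ n)] (f : ∀ n, MvPolynomial (σ n) NNReal),
      (∀ n m, MvPolynomial.coeff m (f n) = 0 ∨ MvPolynomial.coeff m (f n) = 1) →
      Literature.Computability.AlgebraicComplexity.IsVPFamily (k := ℂ)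
        (fun n => MvPolynomial.map (Complex.ofRealHom.comp NNReal.toRealHom) (f n)) →
      ∀ r : ℕ, ∃ n₀ : ℕ, ∀ n ≥ n₀, ∃ h : MvPolynomial (σ n) NNReal, h ≠ 0 ∧
        (Nat.log 2 (complexity (f n * h) + complexity h)) ^ r < n)
    (hE : ∃ r n₀ : ℕ, ∀ n ≥ n₀, ∀ h : MvPolynomial (σ n) ℝ≥0, h ≠ 0 →
      n ≤ (Nat.log 2 (complexity (NN n * h) + complexity h)) ^ r) :
    Summit.ValiantsHypothesis.ValiantsHypothesis.Theses.FifoMatching.NNNotVP := by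
  intro hVP
  have hcoeff : ∀ (n : ℕ) (m : (Fin (2 * n) × Fin (2 * n)) →₀ ℕ),
      MvPolynomial.coeff m (nestFreeMatchingPoly n NNReal) = 0 ∨
      MvPolynomial.coeff m (nestFreeMatchingPoly n NNReal) = 1 :=
    fun n m => coeff_nestFreeMatchingPoly_eq_zero_or_eq_one n m
  have hmap : (fun n => MvPolynomial.map (Complex.ofRealHom.comp NNReal.toRealHom)
        (nestFreeMatchingPoly n NNReal)) = fun n => nestFreeMatchingPoly n ℂ := by
    funext n
    exact map_nestFreeMatchingPoly n _
  have hVP' : IsVPFamily (k := ℂ)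
      (fun n => MvPolynomial.map (Complex.ofRealHom.comp NNReal.toRealHom)
        (nestFreeMatchingPoly n NNReal)) := by
    rw [hmap]
    exact hVP
  obtain ⟨r, n₀, hn₀⟩ := hE
  obtain ⟨n₁, hn₁⟩ := hZse (fun n => Fin (2 * n) × Fin (2 * n))
    (fun n => nestFreeMatchingPoly n NNReal) hcoeff hVP' r
  obtain ⟨h, hh, hlt⟩ := hn₁ (max n₀ n₁) (le_max_right _ _)
  have hle := hn₀ (max n₀ n₁) (le_max_left _ _) h hh
  exact absurd hlt (not_lt.2 hle)

/-- ★ **Z_se ∧ B2 ⟹ `NNNotVP` BY NAME** — the line's composition `NNNotVP_of` with its transfer stub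
Z weakened to sub-exponential rate and its open stub B2 (`stub_spreadCofactorReduction`) verbatim
(`spreadCofactorReduction_iff_expDivisionHard` turns B2 into exponential division hardness).
[folklore] -/
theorem nnNotVP_of_subexpTransfer_of_spreadCofactorReduction
    (hZse : ∀ (σ : ℕ → Type) [∀ n, Fintype (σ n)] (f : ∀ n, MvPolynomial (σ n) NNReal),
      (∀ n m, MvPolynomial.coeff m (f n) = 0 ∨ MvPolynomial.coeff m (f n) = 1) →
      Literature.Computability.AlgebraicComplexity.IsVPFamily (k := ℂ)
        (fun n => MvPolynomial.map (Complex.ofRealHom.comp NNReal.toRealHom) (f n)) →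
      ∀ r : ℕ, ∃ n₀ : ℕ, ∀ n ≥ n₀, ∃ h : MvPolynomial (σ n) NNReal, h ≠ 0 ∧
        (Nat.log 2 (complexity (f n * h) + complexity h)) ^ r < n)
    (hB2 : ∃ k : ℕ, ∀ (n : ℕ) (h : MvPolynomial (σ n) ℝ≥0), h ≠ 0 →
      ∃ h' : MvPolynomial (σ n) ℝ≥0, (∃ m ∈ h'.support, m.support.card ≤ (Nat.log 2 n + k) ^ k) ∧
        complexity (NN n * h') ≤
          2 ^ ((Nat.log 2 n + Nat.log 2 (complexity (NN n * h) + complexity h) + k) ^ k)) :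
    Summit.ValiantsHypothesis.ValiantsHypothesis.Theses.FifoMatching.NNNotVP :=
  nnNotVP_of_subexpTransfer_of_expDivisionHard hZse
    (spreadCofactorReduction_iff_expDivisionHard.1 hB2)

end Summit.ValiantsHypothesis.ValiantsHypothesis.Theorems.FifoMatching.NNNotVP.DivisionSplit

end
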